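import Mathlib.Analysis.Normed.Operator.Basic
import Mathlib.Algebra.Order.BigOperators.Ring.Finset
import Mathlib.Analysis.Real.Sqrt

/-!
# `Balaban1983to89.B9Eq3101DoubleCommutatorBlockSchur` — T. Bałaban, *Propagators for lattice gauge theories in a background field*, Commun. Math.
# Phys. **99** (1985) 389–434 [Balaban1985BackgroundPropagators] (3.101)–(3.104) p. 414 over (3.49) p. 399: **THE COMMUTATOR OF A DECAYING
# OPERATOR WITH A SLOWLY VARYING CUTOFF IS SMALL, UNIFORMLY IN THE VOLUME — THE BLOCK SCHUR TEST AND THE DOUBLE-COMMUTATOR BLOCK LOCALISATION,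
# IN LETTERS: `‖q_B K p_A‖ ≤ 4N·r_{BA}²·τ_{BA}` for `K = Σ_j [χ_j,[χ_j,T]]` and `‖K x‖² ≤ (4N)²·W_r·W_c·‖x‖²`** (a sum over block INDICES only —
# no lattice spacing, no volume) — route R2′ STEP B8′ of the pub-balaban NE9 chain, the S-P5(b) → S-P7 glue, the two 𝕜-general sections

statement-level skeleton of published theorems with citation tags; proofs where landed; nothing here is a claim about the Yang–Mills mass gap

CITATION HEADER (lean-in-tree rule).  Audit cell `pub-balaban`, sub-cell `t4`, BINDER row NE9; filed by NE9 formalisation-swarm LEAF PROVER 01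
(`b2b-balaban-t4-ne9-formalise-leaf-01`, gen 80) as the PORT of the NE9 crux-ideation seat's abstract kernel
`t4/ideate/NE9/lens1-NE9TwoSpaceCauchyBlockSchur.lean` §3–§5 (t4-ne9-idea-1 gen 86, sha16 15b376350ba30591; scratch, never proposed — CREDIT: every
statement and proof idea below is that kernel's; new is only the dress: the two-space commutator is a LETTER `ad` with its defining equation
`ad T = χ_E ∘ T − T ∘ χ_S` as a hypothesis, so the file is `def`-free and a consumer instantiates `ad := fun T => χE ∘L T - T ∘L χS`, `had := fun _ => rfl`),
offered for `t4/ROUTES-NE9.md` v13.23 (v) «the kernel is the SKELETON of the last two items of the S-P5(b) TREE PORT … the abstract §0–§5 are fileable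
statement-first TODAY» (first refusal the row OWNER t4-ne9-p1, second this lineage; nobody's INTENT from journal l.46396 to this seat's ONLINE l.47879).
Companion file (same port, the `ℂ`-analytic sections §1–§2 of the kernel): `B9Eq3101CommutatorCauchyBlockDecay` (the entry letters `τ_{BA}` by
conjugation and the single∕double commutator sizes by Cauchy's estimate).  Source READ in the held text (`paper:balaban1985-cmp99-background-propagators`,
journal page = PDF page + 388): p. 414 (3.101)–(3.104), p. 399 (3.49), p. 398 Thm 3.2 (3.48), p. 415 (the random-walk road for `P`).

THE PRINT (verbatim, p. 414).  *«Now let us consider the commutator [DRD*, h]. We have DRD* = DD* − DPD*. The operator DD* was considered above,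
and DPD* has a regular kernel satisfying (3.49), hence (DPD*hλ)_μ(x) = h(x)(DPD*λ)_μ(x) + Σ_{ν,x′} η^d (DPD*)_{μν}(x,x′)(∂h)(Γ_{x,x′})λ_ν(x′)
= h(x)(DPD*λ)_μ(x) + (P₁(∂h)λ)_μ(x). (3.101)  The operator P₁(∂h) satisfies the inequalities (3.49) with the additional small factor O(M⁻¹) coming
from an estimate of the expression (∂h)(Γ_{x,x′}) together with the exponential decay of DPD*.»*  (3.102)–(3.103) are the same for the averaging
operators `Q_j`, `Q*_aQ`, and (3.104) *«Δ_a hλ = hΔ_a − K(h)λ − …, where K(h) is a sum of a first order differential operator and the last two terms on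
the right-hand side of (3.103)»*.  p. 399 (3.49): the kernels of `P = I − R`, `DP`, `PD*`, `DPD*` are `≤ O(1)[…]e^{−δ₀d(y,y′)}`.  Print PROVES (3.49)
by generalized random-walk expansions (p. 399, p. 415 *«because of the nonlocality of the operator P … we replace the operator P by its random walk
expansion»*); NOTHING of that is asserted here.  IN THE TREE ALREADY: print's ALGEBRA of (3.100)–(3.106) — the covariant Leibniz rule, the two-space kernel
identity behind (3.101)∕(3.102), (3.103)–(3.105) as exact identities — is typed at kernel level by the paper sub-cell b09 in
`B9Eq3105Sum` (pure algebra, no estimate); THIS file is the ESTIMATE side of the same sentence in operator-norm currency and shares no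
declaration with it.

WHY (route R2′ STEP B8′, the S-P5(b) → S-P7 glue, ROUTES-NE9 v13.21 (iii)(d) ∕ v13.23).  The IMS∕localisation error of the plaquette-class step is
`Σ_j re⟪x, [χ_j,[χ_j, H]]x⟫` with `H` quadratic in `D_U` and the NON-local `DP = D_U(1 − R_U)`; the pieces through `D_U` alone are exact Leibniz
(`O(‖∇χ₀‖²∕M²)` pointwise), the piece through `DP` is this file's `K`.  Print's sentence «small factor O(M⁻¹) from (∂h) TOGETHER WITH the exponential
decay» is typed here as: near-constancy radius `r` of the cutoff on a block pair (§4: each commutator with an `r`-near-constant weight costs `2r`,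
not `2‖χ‖`) × block decay `τ_{BA}` (a letter here; produced from a conjugation bound in the companion file) × sparsity `N` (cutoffs meeting neither
block contribute nothing), summed by the block SCHUR test (§3) — which is what removes the number of cutoffs `#{j}` (= the volume) from the bound:
distinct `[χ_j,[χ_j, DP]]` are not block-orthogonal, so sparsity alone gives only `#{j}·sup_j‖[χ_j,[χ_j, DP]]‖`.

WHAT IS PROVED (sorry-free; proof lane — no `def`, no `Prop` placeholder; [folklore] normed-space algebra over a nontrivially normed field `𝕜`,
continuous linear maps `S →L[𝕜] E` between two normed spaces (sites → bonds); nothing of [B9] asserted).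
* §3 THE BLOCK SCHUR TEST: `norm_row_le`; **`block_schur_sq`** — block families `p_A : S →L S` (resolution `Σ_A p_A x = x`, idempotent, UPPER Bessel
  `Σ_A ‖p_A x‖² ≤ ‖x‖²`) and `q_B : E →L E` (LOWER Bessel `‖y‖² ≤ Σ_B ‖q_B y‖²`), `0 ≤ α, β`, row sums `Σ_A ‖q_B K p_A‖ ≤ β`, column sums
  `Σ_B ‖q_B K p_A‖ ≤ α` ⇒ `‖K x‖² ≤ αβ‖x‖²`; **`block_schur_opNorm`** (`‖K‖ ≤ √(αβ)`); **`family_block_schur_sq`** (a finite FAMILY `a_j : S → E`, row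
  sums per pair `(j, B)`, column sums over `(j, B)` per `A` ⇒ `Σ_j ‖a_j x‖² ≤ αβ‖x‖²` — for the first-order square `Σ_j ‖(ad_j T)x‖²` of the IMS identity).  The sign binders `0 ≤ α, β` are LOAD-BEARING (an empty block
  family makes the row hypothesis vacuous) and displayed.
* §4 LOCALISATION (the letter `ad`, `had : ∀ T, ad T = χ_E ∘L T − T ∘L χ_S`): `ad_apply_of_letter`, `ad_zero_of_letter`, `block_ad` (blocks commuting
  with the weights pass through `ad`), **`ad_block_eq_zero`** (a cutoff meeting neither block contributes nothing), **`norm_ad_block_le`** (`q, p`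
  idempotent, `‖(χ_E − c)q‖ ≤ r`, `‖p(χ_S − c)‖ ≤ r` ⇒ `‖ad (qTp)‖ ≤ 2r‖qTp‖`), **`norm_ad_ad_block_le`** (`≤ 4r²‖qTp‖`).
* §5 ASSEMBLY: **`norm_block_sum_adad_le`** (a finite cutoff family `(χ_E j, χ_S j)_{j ∈ s}` commuting with the block pair, only `j ∈ t ⊆ s`, `#t ≤ N`,
  meeting it, each `r`-near-constant there with its own constant `c j`: `‖q (Σ_{j∈s} ad_j(ad_j T)) p‖ ≤ 4N·r²·τ` whenever `‖qTp‖ ≤ τ`);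
  **`norm_sum_adad_sq_le`** (block letters `‖q_B K p_A‖ ≤ 4N·r_{BA}²·τ_{BA}` + weighted Schur sums `Σ_A r²τ ≤ W_r`, `Σ_B r²τ ≤ W_c`, `0 ≤ W_r, W_c` ⇒
  `‖K x‖² ≤ (4N)²·W_r·W_c·‖x‖²` — VOLUME-FREE); **`norm_sum_adad_le`** (`‖K x‖ ≤ 4N·√(W_rW_c)·‖x‖`).  §6 non-vacuity `example`s.
DICTIONARY for the lattice instance (words; nothing lattice is asserted): `T = DP = D_U(1 − R_U) : L²(sites) → L²(bonds)`; `p_A`, `q_B` =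
multiplication by indicators of unit cubes (self-adjoint idempotents of a partition: resolution and both Bessel directions with equality);
`τ_{BA} = c_DP·e^{−κ₁(dist(A,B) − 2)₊}` (companion file, from ONE real conjugation bound per pair); `r_{BA} = ‖∇χ₀‖_∞(2 + dist(A,B))∕M` for the
scale-`M` cutoffs `χ_j = χ₀((· − jM)∕M)`; `N = 2N_d`; `W_r = W_c = C(d, κ₁)·c_DP·‖∇χ₀‖_∞²∕M²` — hence `‖Σ_j[χ_j,[χ_j, DP]]‖ ≤ 8N_d·C(d, κ₁)·c_DP·‖∇χ₀‖_∞²∕M²`.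
HONEST SCOPE.  Symbolic; no lattice, no decay rate, no cutoff is constructed; the `1∕M²` is the consumer's arithmetic on the displayed letters; ONE
input of ONE sub-step of a route step, NOT NE9 (cell pub-balaban: NE9 NOT PRINTED ∕ NOT PROVED; «NE9 ⇐ the named binders»; spine PROVED 0∕9; rung
(B)+1 on a finite T⁴ — NOT infinite volume, NOT mass gap, NOT Clay; HONEST DEPENDENCY: continuum YM on T⁴ ⇐ BetaPertH ∧ nine spine estimates (0/9
proved); BetaPertH ⇐ (D1) ∧ (D4) ∧ CAP+tail; G-an2-4 gates asym, D1 and NE2/3/4).  NEW file, Mathlib-only imports; nothing modified.  Net new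
unproved facts: 0.
-/

namespace Literature.MathematicalPhysics.QuantumFieldTheory.Balaban1983to89.B9Eq3101DoubleCommutatorBlockSchur

open ContinuousLinearMap
open scoped BigOperators

variable {𝕜 : Type*} [NontriviallyNormedField 𝕜]
  {S E : Type*} [NormedAddCommGroup S] [NormedSpace 𝕜 S] [NormedAddCommGroup E] [NormedSpace 𝕜 E]

/-! ## §3 The block Schur test -/

section Schur

variable {ι ι' : Type*} [Fintype ι] [Fintype ι']

/-- one row: `‖q K x‖ ≤ Σ_A ‖q K p_A‖·‖p_A x‖` for idempotents `p_A` resolving the identity. [folklore] (Schur's test, block form)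
[cite: Balaban1985BackgroundPropagators, (3.101) p.414 «together with the exponential decay», (3.49) p.399] -/
theorem norm_row_le (p : ι → S →L[𝕜] S) (K : S →L[𝕜] E) (q : E →L[𝕜] E)
    (hsum : ∀ x, ∑ A, p A x = x) (hidem : ∀ A, p A ∘L p A = p A) (x : S) :
    ‖q (K x)‖ ≤ ∑ A, ‖q ∘L K ∘L p A‖ * ‖p A x‖ := by
  have hx : q (K x) = ∑ A, (q ∘L K ∘L p A) (p A x) := by
    conv_lhs => rw [← hsum x]
    rw [map_sum, map_sum]
    refine Finset.sum_congr rfl fun A _ => ?_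
    have := congrArg (fun f : S →L[𝕜] S => f x) (hidem A)
    simp only [comp_apply] at this
    simp only [comp_apply, this]
  rw [hx]
  exact (norm_sum_le _ _).trans (Finset.sum_le_sum fun A _ => le_opNorm _ _)

/-- **THE BLOCK SCHUR TEST.** Block families `p_A` (idempotents resolving the identity of `S`, upper Bessel `Σ_A ‖p_A x‖² ≤ ‖x‖²`) and `q_B`
(lower Bessel `‖y‖² ≤ Σ_B ‖q_B y‖²` on `E`); row sums `Σ_A ‖q_B K p_A‖ ≤ β`, column sums `Σ_B ‖q_B K p_A‖ ≤ α`, `0 ≤ α, β` (load-bearing: an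
empty family makes the sum hypotheses vacuous) ⇒ `‖K x‖² ≤ αβ‖x‖²`. [folklore] (Schur's test)
[cite: Balaban1985BackgroundPropagators, (3.101) p.414, (3.49) p.399] -/
theorem block_schur_sq (p : ι → S →L[𝕜] S) (q : ι' → E →L[𝕜] E) (K : S →L[𝕜] E)
    (hsum : ∀ x, ∑ A, p A x = x) (hidem : ∀ A, p A ∘L p A = p A)
    (hpS : ∀ x, ∑ A, ‖p A x‖ ^ 2 ≤ ‖x‖ ^ 2) (hqE : ∀ y, ‖y‖ ^ 2 ≤ ∑ B, ‖q B y‖ ^ 2)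
    {α β : ℝ} (hα : 0 ≤ α) (hβ : 0 ≤ β)
    (hrow : ∀ B, ∑ A, ‖q B ∘L K ∘L p A‖ ≤ β) (hcol : ∀ A, ∑ B, ‖q B ∘L K ∘L p A‖ ≤ α) (x : S) :
    ‖K x‖ ^ 2 ≤ α * β * ‖x‖ ^ 2 := by
  have hk0 : ∀ B A, 0 ≤ ‖q B ∘L K ∘L p A‖ := fun B A => norm_nonneg _
  -- each row, squared, by the weighted Cauchy–Schwarz inequality
  have hrow2 : ∀ B, ‖q B (K x)‖ ^ 2 ≤ β * ∑ A, ‖q B ∘L K ∘L p A‖ * ‖p A x‖ ^ 2 := fun B => by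
    have h1 : ‖q B (K x)‖ ^ 2 ≤ (∑ A, ‖q B ∘L K ∘L p A‖ * ‖p A x‖) ^ 2 :=
      pow_le_pow_left₀ (norm_nonneg _) (norm_row_le p K (q B) hsum hidem x) 2
    have h2 : (∑ A, ‖q B ∘L K ∘L p A‖ * ‖p A x‖) ^ 2 ≤
        (∑ A, ‖q B ∘L K ∘L p A‖) * ∑ A, ‖q B ∘L K ∘L p A‖ * ‖p A x‖ ^ 2 :=
      Finset.sum_sq_le_sum_mul_sum_of_sq_le_mul _ (fun A _ => hk0 B A)
        (fun A _ => mul_nonneg (hk0 B A) (sq_nonneg _)) (fun A _ => le_of_eq (by ring))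
    have h3 : (∑ A, ‖q B ∘L K ∘L p A‖) * ∑ A, ‖q B ∘L K ∘L p A‖ * ‖p A x‖ ^ 2 ≤
        β * ∑ A, ‖q B ∘L K ∘L p A‖ * ‖p A x‖ ^ 2 :=
      mul_le_mul_of_nonneg_right (hrow B) (Finset.sum_nonneg fun A _ => mul_nonneg (hk0 B A) (sq_nonneg _))
    exact h1.trans (h2.trans h3)
  calc ‖K x‖ ^ 2 ≤ ∑ B, ‖q B (K x)‖ ^ 2 := hqE (K x)
    _ ≤ ∑ B, β * ∑ A, ‖q B ∘L K ∘L p A‖ * ‖p A x‖ ^ 2 := Finset.sum_le_sum fun B _ => hrow2 B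
    _ = β * ∑ A, (∑ B, ‖q B ∘L K ∘L p A‖) * ‖p A x‖ ^ 2 := by
      rw [← Finset.mul_sum, Finset.sum_comm]; congr 1
      exact Finset.sum_congr rfl fun A _ => by rw [Finset.sum_mul]
    _ ≤ β * ∑ A, α * ‖p A x‖ ^ 2 := by
      gcongr with A _
      exact hcol A
    _ = α * β * ∑ A, ‖p A x‖ ^ 2 := by rw [← Finset.mul_sum]; ring
    _ ≤ α * β * ‖x‖ ^ 2 := mul_le_mul_of_nonneg_left (hpS x) (mul_nonneg hα hβ)

/-- operator-norm form of the block Schur test: `‖K‖ ≤ √(αβ)`. [folklore] (Schur's test)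
[cite: Balaban1985BackgroundPropagators, (3.101) p.414, (3.49) p.399] -/
theorem block_schur_opNorm (p : ι → S →L[𝕜] S) (q : ι' → E →L[𝕜] E) (K : S →L[𝕜] E)
    (hsum : ∀ x, ∑ A, p A x = x) (hidem : ∀ A, p A ∘L p A = p A)
    (hpS : ∀ x, ∑ A, ‖p A x‖ ^ 2 ≤ ‖x‖ ^ 2) (hqE : ∀ y, ‖y‖ ^ 2 ≤ ∑ B, ‖q B y‖ ^ 2)
    {α β : ℝ} (hα : 0 ≤ α) (hβ : 0 ≤ β)
    (hrow : ∀ B, ∑ A, ‖q B ∘L K ∘L p A‖ ≤ β) (hcol : ∀ A, ∑ B, ‖q B ∘L K ∘L p A‖ ≤ α) :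
    ‖K‖ ≤ Real.sqrt (α * β) := by
  refine opNorm_le_bound _ (Real.sqrt_nonneg _) fun x => ?_
  have h := block_schur_sq p q K hsum hidem hpS hqE hα hβ hrow hcol x
  have h' : ‖K x‖ ^ 2 ≤ (Real.sqrt (α * β) * ‖x‖) ^ 2 := by
    rw [mul_pow, Real.sq_sqrt (mul_nonneg hα hβ)]; exact h
  exact (pow_le_pow_iff_left₀ (norm_nonneg _) (mul_nonneg (Real.sqrt_nonneg _) (norm_nonneg _)) two_ne_zero).mp h'

/-- **THE FAMILY SCHUR TEST** (for the first-order square `Σ_j ‖(ad_j T)x‖²` of the IMS identity): a finite family `a_j : S → E`, source blocks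
as in `block_schur_sq`, target blocks with LOWER Bessel; entry bounds with row sums `Σ_A ‖q_B a_j p_A‖ ≤ β` for every PAIR `(j, B)` and column
sums `Σ_{j,B} ‖q_B a_j p_A‖ ≤ α` for every `A`, `0 ≤ α, β` ⇒ `Σ_j ‖a_j x‖² ≤ αβ‖x‖²` — volume-free (the case of one `j` is `block_schur_sq`).
[folklore] (Schur's test) [cite: Balaban1985BackgroundPropagators, (3.101) p.414, (3.49) p.399] -/
theorem family_block_schur_sq {J : Type*} (s : Finset J) (p : ι → S →L[𝕜] S) (q : ι' → E →L[𝕜] E) (a : J → S →L[𝕜] E)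
    (hsum : ∀ x, ∑ A, p A x = x) (hidem : ∀ A, p A ∘L p A = p A)
    (hpS : ∀ x, ∑ A, ‖p A x‖ ^ 2 ≤ ‖x‖ ^ 2) (hqE : ∀ y, ‖y‖ ^ 2 ≤ ∑ B, ‖q B y‖ ^ 2)
    {α β : ℝ} (hα : 0 ≤ α) (hβ : 0 ≤ β)
    (hrow : ∀ j ∈ s, ∀ B, ∑ A, ‖q B ∘L a j ∘L p A‖ ≤ β) (hcol : ∀ A, ∑ j ∈ s, ∑ B, ‖q B ∘L a j ∘L p A‖ ≤ α) (x : S) :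
    ∑ j ∈ s, ‖a j x‖ ^ 2 ≤ α * β * ‖x‖ ^ 2 := by
  have hk0 : ∀ j B A, 0 ≤ ‖q B ∘L a j ∘L p A‖ := fun j B A => norm_nonneg _
  have hrow2 : ∀ j ∈ s, ∀ B, ‖q B (a j x)‖ ^ 2 ≤ β * ∑ A, ‖q B ∘L a j ∘L p A‖ * ‖p A x‖ ^ 2 := fun j hj B => by
    have h1 : ‖q B (a j x)‖ ^ 2 ≤ (∑ A, ‖q B ∘L a j ∘L p A‖ * ‖p A x‖) ^ 2 :=
      pow_le_pow_left₀ (norm_nonneg _) (norm_row_le p (a j) (q B) hsum hidem x) 2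
    have h2 : (∑ A, ‖q B ∘L a j ∘L p A‖ * ‖p A x‖) ^ 2 ≤
        (∑ A, ‖q B ∘L a j ∘L p A‖) * ∑ A, ‖q B ∘L a j ∘L p A‖ * ‖p A x‖ ^ 2 :=
      Finset.sum_sq_le_sum_mul_sum_of_sq_le_mul _ (fun A _ => hk0 j B A)
        (fun A _ => mul_nonneg (hk0 j B A) (sq_nonneg _)) (fun A _ => le_of_eq (by ring))
    have h3 : (∑ A, ‖q B ∘L a j ∘L p A‖) * ∑ A, ‖q B ∘L a j ∘L p A‖ * ‖p A x‖ ^ 2 ≤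
        β * ∑ A, ‖q B ∘L a j ∘L p A‖ * ‖p A x‖ ^ 2 :=
      mul_le_mul_of_nonneg_right (hrow j hj B) (Finset.sum_nonneg fun A _ => mul_nonneg (hk0 j B A) (sq_nonneg _))
    exact h1.trans (h2.trans h3)
  calc ∑ j ∈ s, ‖a j x‖ ^ 2 ≤ ∑ j ∈ s, ∑ B, ‖q B (a j x)‖ ^ 2 := Finset.sum_le_sum fun j _ => hqE (a j x)
    _ ≤ ∑ j ∈ s, ∑ B, β * ∑ A, ‖q B ∘L a j ∘L p A‖ * ‖p A x‖ ^ 2 :=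
        Finset.sum_le_sum fun j hj => Finset.sum_le_sum fun B _ => hrow2 j hj B
    _ = β * ∑ A, (∑ j ∈ s, ∑ B, ‖q B ∘L a j ∘L p A‖) * ‖p A x‖ ^ 2 := by
        have e1 : ∀ j ∈ s, ∑ B, β * ∑ A, ‖q B ∘L a j ∘L p A‖ * ‖p A x‖ ^ 2 =
            β * ∑ A, ∑ B, ‖q B ∘L a j ∘L p A‖ * ‖p A x‖ ^ 2 := fun j _ => by
          rw [← Finset.mul_sum, Finset.sum_comm]
        rw [Finset.sum_congr rfl e1, ← Finset.mul_sum, Finset.sum_comm]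
        congr 1
        refine Finset.sum_congr rfl fun A _ => ?_
        rw [Finset.sum_mul]
        exact Finset.sum_congr rfl fun j _ => by rw [Finset.sum_mul]
    _ ≤ β * ∑ A, α * ‖p A x‖ ^ 2 := by
        gcongr with A _
        exact hcol A
    _ = α * β * ∑ A, ‖p A x‖ ^ 2 := by rw [← Finset.mul_sum]; ring
    _ ≤ α * β * ‖x‖ ^ 2 := mul_le_mul_of_nonneg_left (hpS x) (mul_nonneg hα hβ)

end Schur

/-! ## §4 Double-commutator block localisation (the two-space commutator as a LETTER `ad`, `ad T = χ_E ∘ T − T ∘ χ_S`) -/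

section Localise

/-- the letter unfolded at a point: `ad T x = χ_E (T x) − T (χ_S x)`. [folklore]
[cite: Balaban1985BackgroundPropagators, (3.101) p.414] -/
theorem ad_apply_of_letter {χE : E →L[𝕜] E} {χS : S →L[𝕜] S} {ad : (S →L[𝕜] E) → (S →L[𝕜] E)}
    (had : ∀ T, ad T = χE ∘L T - T ∘L χS) (T : S →L[𝕜] E) (x : S) : ad T x = χE (T x) - T (χS x) := by
  rw [had]; rfl

/-- `ad 0 = 0`. [folklore] [cite: Balaban1985BackgroundPropagators, (3.101) p.414] -/
theorem ad_zero_of_letter {χE : E →L[𝕜] E} {χS : S →L[𝕜] S} {ad : (S →L[𝕜] E) → (S →L[𝕜] E)}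
    (had : ∀ T, ad T = χE ∘L T - T ∘L χS) : ad 0 = 0 := by
  ext x; simp [ad_apply_of_letter had]

/-- blocks commuting with the weights pass through `ad`: `q (ad T) p = ad (q T p)`. [folklore]
[cite: Balaban1985BackgroundPropagators, (3.101) p.414] -/
theorem block_ad {χE : E →L[𝕜] E} {χS : S →L[𝕜] S} {ad : (S →L[𝕜] E) → (S →L[𝕜] E)}
    (had : ∀ T, ad T = χE ∘L T - T ∘L χS) (q : E →L[𝕜] E) (p : S →L[𝕜] S) (T : S →L[𝕜] E)
    (hq : q ∘L χE = χE ∘L q) (hp : p ∘L χS = χS ∘L p) :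
    q ∘L ad T ∘L p = ad (q ∘L T ∘L p) := by
  have hq' : ∀ y, q (χE y) = χE (q y) := fun y => by
    simpa using congrArg (fun f : E →L[𝕜] E => f y) hq
  have hp' : ∀ x, p (χS x) = χS (p x) := fun x => by
    simpa using congrArg (fun f : S →L[𝕜] S => f x) hp
  ext x
  simp [ad_apply_of_letter had, map_sub, hq', hp']

/-- **A CUTOFF MEETING NEITHER BLOCK CONTRIBUTES NOTHING**: `χ_E q = 0`, `p χ_S = 0` ⇒ `ad (q T p) = 0`. [folklore]
[cite: Balaban1985BackgroundPropagators, (3.101) p.414 «(∂h)(Γ_{x,x′})», (3.49) p.399] -/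
theorem ad_block_eq_zero {χE : E →L[𝕜] E} {χS : S →L[𝕜] S} {ad : (S →L[𝕜] E) → (S →L[𝕜] E)}
    (had : ∀ T, ad T = χE ∘L T - T ∘L χS) (q : E →L[𝕜] E) (p : S →L[𝕜] S) (T : S →L[𝕜] E)
    (hq : χE ∘L q = 0) (hp : p ∘L χS = 0) : ad (q ∘L T ∘L p) = 0 := by
  have hq' : ∀ y, χE (q y) = 0 := fun y => by
    simpa using congrArg (fun f : E →L[𝕜] E => f y) hq
  have hp' : ∀ x, p (χS x) = 0 := fun x => by
    simpa using congrArg (fun f : S →L[𝕜] S => f x) hp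
  ext x
  simp [ad_apply_of_letter had, hq', hp']

/-- **NEAR-CONSTANT WEIGHTS COST `2r` PER COMMUTATOR** (print's «small factor O(M⁻¹) coming from (∂h)»): `q, p` idempotent, the weight within `r`
of ONE constant `c` on both blocks (`‖(χ_E − c)q‖ ≤ r`, `‖p(χ_S − c)‖ ≤ r`) ⇒ `‖ad (qTp)‖ ≤ 2r‖qTp‖`. [folklore]
[cite: Balaban1985BackgroundPropagators, (3.101) p.414, (3.104) p.414] -/
theorem norm_ad_block_le {χE : E →L[𝕜] E} {χS : S →L[𝕜] S} {ad : (S →L[𝕜] E) → (S →L[𝕜] E)}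
    (had : ∀ T, ad T = χE ∘L T - T ∘L χS) (q : E →L[𝕜] E) (p : S →L[𝕜] S) (T : S →L[𝕜] E) (c : 𝕜) {r : ℝ}
    (hqi : q ∘L q = q) (hpi : p ∘L p = p)
    (hqr : ‖(χE - c • (1 : E →L[𝕜] E)) ∘L q‖ ≤ r) (hpr : ‖p ∘L (χS - c • (1 : S →L[𝕜] S))‖ ≤ r) :
    ‖ad (q ∘L T ∘L p)‖ ≤ 2 * r * ‖q ∘L T ∘L p‖ := by
  have hqq : ∀ y, q (q y) = q y := fun y => by
    simpa using congrArg (fun f : E →L[𝕜] E => f y) hqi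
  have hpp : ∀ x, p (p x) = p x := fun x => by
    simpa using congrArg (fun f : S →L[𝕜] S => f x) hpi
  have hK : ad (q ∘L T ∘L p) = ((χE - c • (1 : E →L[𝕜] E)) ∘L q) ∘L (q ∘L T ∘L p) -
      (q ∘L T ∘L p) ∘L (p ∘L (χS - c • (1 : S →L[𝕜] S))) := by
    ext x
    simp only [ad_apply_of_letter had, comp_apply, sub_apply, smul_apply, one_apply_eq_self, map_sub,
      map_smul, hqq, hpp]
    abel
  rw [hK]
  refine (norm_sub_le _ _).trans ?_
  have h1 : ‖((χE - c • (1 : E →L[𝕜] E)) ∘L q) ∘L (q ∘L T ∘L p)‖ ≤ r * ‖q ∘L T ∘L p‖ :=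
    (opNorm_comp_le _ _).trans (mul_le_mul_of_nonneg_right hqr (norm_nonneg _))
  have h2 : ‖(q ∘L T ∘L p) ∘L (p ∘L (χS - c • (1 : S →L[𝕜] S)))‖ ≤ ‖q ∘L T ∘L p‖ * r :=
    (opNorm_comp_le _ _).trans (mul_le_mul_of_nonneg_left hpr (norm_nonneg _))
  linarith

/-- … hence the block entry of a DOUBLE commutator with a near-constant weight: `‖ad (ad (qTp))‖ ≤ 4r²‖qTp‖`. [folklore]
[cite: Balaban1985BackgroundPropagators, (3.101) p.414, (3.104) p.414] -/
theorem norm_ad_ad_block_le {χE : E →L[𝕜] E} {χS : S →L[𝕜] S} {ad : (S →L[𝕜] E) → (S →L[𝕜] E)}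
    (had : ∀ T, ad T = χE ∘L T - T ∘L χS) (q : E →L[𝕜] E) (p : S →L[𝕜] S) (T : S →L[𝕜] E) (c : 𝕜) {r : ℝ}
    (hq : q ∘L χE = χE ∘L q) (hp : p ∘L χS = χS ∘L p) (hqi : q ∘L q = q) (hpi : p ∘L p = p)
    (hqr : ‖(χE - c • (1 : E →L[𝕜] E)) ∘L q‖ ≤ r) (hpr : ‖p ∘L (χS - c • (1 : S →L[𝕜] S))‖ ≤ r) :
    ‖ad (ad (q ∘L T ∘L p))‖ ≤ 4 * r ^ 2 * ‖q ∘L T ∘L p‖ := by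
  have hr : 0 ≤ r := (norm_nonneg _).trans hqr
  rw [← block_ad had q p T hq hp]
  calc ‖ad (q ∘L ad T ∘L p)‖ ≤ 2 * r * ‖q ∘L ad T ∘L p‖ := norm_ad_block_le had q p (ad T) c hqi hpi hqr hpr
    _ = 2 * r * ‖ad (q ∘L T ∘L p)‖ := by rw [block_ad had q p T hq hp]
    _ ≤ 2 * r * (2 * r * ‖q ∘L T ∘L p‖) := by
        gcongr
        exact norm_ad_block_le had q p T c hqi hpi hqr hpr
    _ = 4 * r ^ 2 * ‖q ∘L T ∘L p‖ := by ring

end Localise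

/-! ## §5 Assembly: the block entries of `K = Σ_j ad_j (ad_j T)` and the volume-free Schur bound -/

section Assembly

/-- **THE ENTRY BOUND** `‖q (Σ_{j∈s} ad_j(ad_j T)) p‖ ≤ 4N·r²·τ`: a finite cutoff family `(χ_E j, χ_S j)` commuting with the block pair, of which
only `j ∈ t ⊆ s` (`#t ≤ N`) meet it (`j ∈ s ∖ t ⇒ χ_E j ∘ q = 0 ∧ p ∘ χ_S j = 0`), each meeting one `r`-near a constant `c j` on both blocks, and
`‖qTp‖ ≤ τ`. [folklore] [cite: Balaban1985BackgroundPropagators, (3.101) p.414 «small factor O(M⁻¹) … together with the exponential decay», (3.49) p.399] -/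
theorem norm_block_sum_adad_le {J : Type*} [DecidableEq J] (s t : Finset J) (hts : t ⊆ s) {N : ℕ} (htN : t.card ≤ N)
    (χE : J → E →L[𝕜] E) (χS : J → S →L[𝕜] S) {ad : J → (S →L[𝕜] E) → (S →L[𝕜] E)}
    (had : ∀ j T, ad j T = χE j ∘L T - T ∘L χS j) (q : E →L[𝕜] E) (p : S →L[𝕜] S) (T : S →L[𝕜] E)
    (hq : ∀ j ∈ s, q ∘L χE j = χE j ∘L q) (hp : ∀ j ∈ s, p ∘L χS j = χS j ∘L p)
    (hqi : q ∘L q = q) (hpi : p ∘L p = p)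
    (hoff : ∀ j ∈ s, j ∉ t → χE j ∘L q = 0 ∧ p ∘L χS j = 0)
    (c : J → 𝕜) {r τ : ℝ}
    (hr : ∀ j ∈ t, ‖(χE j - c j • (1 : E →L[𝕜] E)) ∘L q‖ ≤ r ∧ ‖p ∘L (χS j - c j • (1 : S →L[𝕜] S))‖ ≤ r)
    (hτ : ‖q ∘L T ∘L p‖ ≤ τ) :
    ‖q ∘L (∑ j ∈ s, ad j (ad j T)) ∘L p‖ ≤ 4 * N * r ^ 2 * τ := by
  have hτ0 : 0 ≤ τ := (norm_nonneg _).trans hτ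
  -- entries: `q (ad_j ad_j T) p = ad_j (ad_j (q T p))`
  have hentry : ∀ j ∈ s, q ∘L ad j (ad j T) ∘L p = ad j (ad j (q ∘L T ∘L p)) := fun j hj => by
    rw [block_ad (had j) q p _ (hq j hj) (hp j hj), block_ad (had j) q p _ (hq j hj) (hp j hj)]
  have hsum : q ∘L (∑ j ∈ s, ad j (ad j T)) ∘L p = ∑ j ∈ t, ad j (ad j (q ∘L T ∘L p)) := by
    rw [finsetSum_comp, comp_finsetSum, ← Finset.sum_subset hts]
    · exact Finset.sum_congr rfl fun j hj => hentry j (hts hj)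
    · intro j hj hjt
      rw [hentry j hj, ad_block_eq_zero (had j) q p _ (hoff j hj hjt).1 (hoff j hj hjt).2, ad_zero_of_letter (had j)]
  rw [hsum]
  by_cases ht : t.Nonempty
  · obtain ⟨j₀, hj₀⟩ := ht
    have hr0 : 0 ≤ r := (norm_nonneg _).trans (hr j₀ hj₀).1
    calc ‖∑ j ∈ t, ad j (ad j (q ∘L T ∘L p))‖
        ≤ ∑ j ∈ t, ‖ad j (ad j (q ∘L T ∘L p))‖ := norm_sum_le _ _
      _ ≤ ∑ j ∈ t, 4 * r ^ 2 * τ := Finset.sum_le_sum fun j hj =>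
          (norm_ad_ad_block_le (had j) q p T (c j) (hq j (hts hj)) (hp j (hts hj)) hqi hpi (hr j hj).1 (hr j hj).2).trans
            (mul_le_mul_of_nonneg_left hτ (by positivity))
      _ = t.card * (4 * r ^ 2 * τ) := by rw [Finset.sum_const, nsmul_eq_mul]
      _ ≤ N * (4 * r ^ 2 * τ) := mul_le_mul_of_nonneg_right (by exact_mod_cast htN) (by positivity)
      _ = 4 * N * r ^ 2 * τ := by ring
  · rw [Finset.not_nonempty_iff_eq_empty.mp ht, Finset.sum_empty, norm_zero]
    positivity

variable {ι ι' : Type*} [Fintype ι] [Fintype ι']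

/-- **THE VOLUME-FREE BOUND.** Block families as in the Schur test (§3), entry bounds `‖q_B K p_A‖ ≤ 4N·r_{BA}²·τ_{BA}` (§5 `norm_block_sum_adad_le`,
fed by the companion file's decay letters `τ` and §4's radii `r`) and weighted Schur sums `Σ_A r²τ ≤ W_r`, `Σ_B r²τ ≤ W_c` with `0 ≤ W_r, W_c`
(load-bearing) ⇒ `‖K x‖² ≤ (4N)²·W_r·W_c·‖x‖²` — a sum over block indices only. [folklore] (Schur's test)
[cite: Balaban1985BackgroundPropagators, (3.101) p.414, (3.104) p.414, (3.49) p.399] -/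
theorem norm_sum_adad_sq_le (p : ι → S →L[𝕜] S) (q : ι' → E →L[𝕜] E) (K : S →L[𝕜] E)
    (hsum : ∀ x, ∑ A, p A x = x) (hidem : ∀ A, p A ∘L p A = p A)
    (hpS : ∀ x, ∑ A, ‖p A x‖ ^ 2 ≤ ‖x‖ ^ 2) (hqE : ∀ y, ‖y‖ ^ 2 ≤ ∑ B, ‖q B y‖ ^ 2)
    {N : ℕ} (r τ : ι' → ι → ℝ)
    (hK : ∀ B A, ‖q B ∘L K ∘L p A‖ ≤ 4 * N * r B A ^ 2 * τ B A)
    {Wr Wc : ℝ} (hWr0 : 0 ≤ Wr) (hWc0 : 0 ≤ Wc)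
    (hWr : ∀ B, ∑ A, r B A ^ 2 * τ B A ≤ Wr) (hWc : ∀ A, ∑ B, r B A ^ 2 * τ B A ≤ Wc) (x : S) :
    ‖K x‖ ^ 2 ≤ (4 * N) ^ 2 * Wr * Wc * ‖x‖ ^ 2 := by
  have h := block_schur_sq p q K hsum hidem hpS hqE (α := 4 * N * Wc) (β := 4 * N * Wr) (by positivity) (by positivity)
    (fun B => by
      calc ∑ A, ‖q B ∘L K ∘L p A‖ ≤ ∑ A, 4 * N * r B A ^ 2 * τ B A := Finset.sum_le_sum fun A _ => hK B A
        _ = 4 * N * ∑ A, r B A ^ 2 * τ B A := by rw [Finset.mul_sum]; exact Finset.sum_congr rfl fun A _ => by ring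
        _ ≤ 4 * N * Wr := by gcongr; exact hWr B)
    (fun A => by
      calc ∑ B, ‖q B ∘L K ∘L p A‖ ≤ ∑ B, 4 * N * r B A ^ 2 * τ B A := Finset.sum_le_sum fun B _ => hK B A
        _ = 4 * N * ∑ B, r B A ^ 2 * τ B A := by rw [Finset.mul_sum]; exact Finset.sum_congr rfl fun B _ => by ring
        _ ≤ 4 * N * Wc := by gcongr; exact hWc A) x
  calc ‖K x‖ ^ 2 ≤ 4 * N * Wc * (4 * N * Wr) * ‖x‖ ^ 2 := h
    _ = (4 * N) ^ 2 * Wr * Wc * ‖x‖ ^ 2 := by ring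

/-- … the same in first-power form: `‖K x‖ ≤ 4N·√(W_r·W_c)·‖x‖`. [folklore] (Schur's test)
[cite: Balaban1985BackgroundPropagators, (3.101) p.414, (3.49) p.399] -/
theorem norm_sum_adad_le (p : ι → S →L[𝕜] S) (q : ι' → E →L[𝕜] E) (K : S →L[𝕜] E)
    (hsum : ∀ x, ∑ A, p A x = x) (hidem : ∀ A, p A ∘L p A = p A)
    (hpS : ∀ x, ∑ A, ‖p A x‖ ^ 2 ≤ ‖x‖ ^ 2) (hqE : ∀ y, ‖y‖ ^ 2 ≤ ∑ B, ‖q B y‖ ^ 2)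
    {N : ℕ} (r τ : ι' → ι → ℝ)
    (hK : ∀ B A, ‖q B ∘L K ∘L p A‖ ≤ 4 * N * r B A ^ 2 * τ B A)
    {Wr Wc : ℝ} (hWr0 : 0 ≤ Wr) (hWc0 : 0 ≤ Wc)
    (hWr : ∀ B, ∑ A, r B A ^ 2 * τ B A ≤ Wr) (hWc : ∀ A, ∑ B, r B A ^ 2 * τ B A ≤ Wc) (x : S) :
    ‖K x‖ ≤ 4 * N * Real.sqrt (Wr * Wc) * ‖x‖ := by
  have h := norm_sum_adad_sq_le p q K hsum hidem hpS hqE r τ hK hWr0 hWc0 hWr hWc x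
  have hs : Real.sqrt (Wr * Wc) ^ 2 = Wr * Wc := Real.sq_sqrt (mul_nonneg hWr0 hWc0)
  have h' : ‖K x‖ ^ 2 ≤ (4 * N * Real.sqrt (Wr * Wc) * ‖x‖) ^ 2 := by
    calc ‖K x‖ ^ 2 ≤ (4 * N) ^ 2 * Wr * Wc * ‖x‖ ^ 2 := h
      _ = (4 * N) ^ 2 * (Real.sqrt (Wr * Wc) ^ 2) * ‖x‖ ^ 2 := by rw [hs]; ring
      _ = (4 * N * Real.sqrt (Wr * Wc) * ‖x‖) ^ 2 := by ring
  exact (pow_le_pow_iff_left₀ (norm_nonneg _) (by positivity) two_ne_zero).mp h'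

end Assembly

/-! ## §6 Non-vacuity -/

/-- §3's letters at one block on each side (`p = q = 1` on `𝕜`), `K = 1`, `α = β = 1`: the hypotheses hold and the bound is `‖x‖² ≤ ‖x‖²`.
[folklore] [cite: Balaban1985BackgroundPropagators, (3.49) p.399] -/
example (x : 𝕜) : ‖(1 : 𝕜 →L[𝕜] 𝕜) x‖ ^ 2 ≤ 1 * 1 * ‖x‖ ^ 2 :=
  have h1 : ‖(1 : 𝕜 →L[𝕜] 𝕜) ∘L (1 : 𝕜 →L[𝕜] 𝕜) ∘L (1 : 𝕜 →L[𝕜] 𝕜)‖ ≤ 1 := by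
    rw [show (1 : 𝕜 →L[𝕜] 𝕜) ∘L (1 : 𝕜 →L[𝕜] 𝕜) ∘L (1 : 𝕜 →L[𝕜] 𝕜) = ContinuousLinearMap.id 𝕜 𝕜 by ext; simp]
    exact norm_id_le
  block_schur_sq (ι := Unit) (ι' := Unit) (fun _ => (1 : 𝕜 →L[𝕜] 𝕜)) (fun _ => (1 : 𝕜 →L[𝕜] 𝕜)) 1
    (fun x => by simp) (fun _ => by ext; simp) (fun x => by simp) (fun y => by simp) zero_le_one zero_le_one
    (fun _ => by simpa using h1) (fun _ => by simpa using h1) x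

/-- §4's letters with the ZERO weight (`c = 0`, `r = 0`): `ad (qTp) = 0`, consistent with `‖ad (qTp)‖ ≤ 2·0·‖qTp‖`. [folklore]
[cite: Balaban1985BackgroundPropagators, (3.101) p.414] -/
example (T : S →L[𝕜] E) : ‖(0 : E →L[𝕜] E) ∘L T - T ∘L (0 : S →L[𝕜] S)‖ ≤ 2 * 0 * ‖(1 : E →L[𝕜] E) ∘L T ∘L (1 : S →L[𝕜] S)‖ := by
  have h := norm_ad_block_le (χE := (0 : E →L[𝕜] E)) (χS := (0 : S →L[𝕜] S)) (ad := fun T => 0 ∘L T - T ∘L 0) (fun _ => rfl)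
    1 1 T (0 : 𝕜) (r := 0) (by ext; simp) (by ext; simp) (by simp) (by simp)
  exact h

end Literature.MathematicalPhysics.QuantumFieldTheory.Balaban1983to89.B9Eq3101DoubleCommutatorBlockSchur
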